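import Literature.AnabelianGeometry.SemiGraphs.TemperedEdgeLikeDistinctProofsAt
import Literature.AnabelianGeometry.SemiGraphs.TemperedConj2OfLocallyFinite
import Literature.AnabelianGeometry.SemiGraphs.TemperedVerticialNamedFactsProofs
import Literature.AnabelianGeometry.SemiGraphs.TemperedVerticialDistinctSameVertex
import Literature.AnabelianGeometry.SemiGraphs.ThetaRayRefutationMaximalCompact
import HarnessLib

/-!
# [SemiAnbd] Thm 3.7: edge-like subgroups of distinct edges meet trivially — at EVERY locally finite graph,
# unconditionally (F-1699 `EdgeLikeDistinct`, instance form; L-F pack A)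

Mochizuki, *Semi-graphs of anabelioids*, Publ. RIMS **42** (2006), §3, Theorem 3.7 (ii)–(iv), manuscript
pp. 40–41 [cite: MochizukiSemiAnbd2006, Thm 3.7(iv) p.41], as used silently in the proof of Cor. 3.9 p. 42 («by
considering nontrivial intersections of maximal compact subgroups, one obtains … a map from the edges [of] `G` to
the edges of `H`»): edge-like subgroups of DISTINCT edges have trivial intersection, hence infinite mutual index.

PROOF-ONLY file (abc-iut cell, layer L3, D-0079 L-F sub-cell [SemiAnbd]+[CombGC] pack A, row F-1699; seat
abc-iut-L3-d4 gen 4, sequel of its typed-form sweep at `𝒢_θ`; 0 definitions, no named fact, no hypothesis beyond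
print's and local finiteness).  The cell's ∀-countable named fact `EdgeLikeDistinct` (F-1699) has in-tree closers
only through `CompactInVerticial(At)` (abc-iut-w4-d075 `edgeLike_inf_edgeLike_eq_bot_at` /
`relIndex_edgeLike_eq_zero_at`, `edgeLikeDistinctAt_of`), i.e. through [SemiAnbd] Thm 3.7 (iii), whose ∀-countable
typing is kernel-REFUTED at `𝒢_θ` (p442260) — but those proofs use ONLY the second conjunct of (iii) («a nontrivial
compact subgroup in two distinct verticial subgroups lies in no third and in an edge-like subgroup of a closed
edge»), which abc-iut-w6-d062 proved at every LOCALLY FINITE countable graph satisfying the hypotheses of Thm 3.7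
(`compactInTwoVerticial_of_isLocallyFinite`, `TemperedConj2OfLocallyFinite.lean`).  Porting w4-d075's proof
verbatim with that one input swapped gives, at every locally finite Thm-3.7 graph and every chart, with Thm 3.7
(i)/(ii) bound to the tree's `verticialInjective_holds` / `verticialDistinct_holds`:

* `edgeLike_inf_edgeLike_eq_bot_of_isLocallyFinite` — `L₁ ⊓ L₂ = ⊥` for edge-like `L₁`, `L₂` of edges `e₁ ≠ e₂`;
* `relIndex_edgeLike_eq_zero_of_isLocallyFinite` — `L₂.relIndex L₁ = 0`;
* `edgeLikeDistinctAt_of_isLocallyFinite : EdgeLikeDistinctAt 𝒢` — the instance form of F-1699, unconditional;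
* instances at the countermodel of the (iii) refutation: `thetaRay_edgeLikeDistinctAt`,
  `thetaRayFreeProP_edgeLikeDistinctAt` (the ray is locally finite) — so F-1699 HOLDS at `𝒢_θ` in the kernel.

The genuine carriers of the IUT corpus (dual semi-graphs of pointed stable curves) are finite, hence locally
finite; for them this is the already-landed `edgeLikeDistinctAt_of_finiteGraph`.  Nothing here bears on
[IUTchIII] Cor. 3.12; no side taken; typed ≠ proved.
-/

namespace Literature.AnabelianGeometry.SemiGraphs

namespace ProfiniteSemiGraph

open Topology

universe u

variable {𝒢 : ProfiniteSemiGraph.{u}}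

/-- **Edge-like subgroups of distinct edges meet trivially, at every locally finite Thm-3.7 graph** (every
chart).  abc-iut-w4-d075's `edgeLike_inf_edgeLike_eq_bot_at` verbatim, with the second conjunct of Thm 3.7 (iii)
supplied by abc-iut-w6-d062's `compactInTwoVerticial_of_isLocallyFinite` instead of the hypothesis
`CompactInVerticialAt 𝒢`. [cite: MochizukiSemiAnbd2006, Thm 3.7(iv) p.41] -/
theorem edgeLike_inf_edgeLike_eq_bot_of_isLocallyFinite (h𝒢 : 𝒢.Thm37Hypotheses)
    (hlf : 𝒢.graph.IsLocallyFinite) (c : TemperedPiChart 𝒢)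
    {e₁ e₂ : 𝒢.graph.Edge} (hne : e₁ ≠ e₂) {L₁ L₂ : Subgroup c.G} (hL₁ : L₁ ∈ edgeLikeSubgroups c e₁)
    (hL₂ : L₂ ∈ edgeLikeSubgroups c e₂) : L₁ ⊓ L₂ = ⊥ := by
  classical
  have hVD : VerticialDistinct.{u} := verticialDistinct_holds
  have hVI : VerticialInjective.{u} := verticialInjective_holds
  haveI := TemperedPiChart.t2Space c
  -- one verticial homomorphism per vertex
  have hΦ' : ∀ v : 𝒢.graph.Vertex, ∃ φ : 𝒢.Gv v →ₜ* c.G, IsVerticialHom c v φ := by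
    intro v
    obtain ⟨H, φ, hφ, -⟩ := (hVI 𝒢 h𝒢 c v).1
    exact ⟨φ, hφ⟩
  choose Φ hΦ using hΦ'
  -- attached branches of `e₁`, `e₂`
  obtain ⟨w⟩ := h𝒢.hasVertex
  obtain ⟨b₁, hbe₁, hs₁⟩ := SemiGraph.exists_abuts_of_isConnected h𝒢.isConnected w e₁
  obtain ⟨b₂, hbe₂, hs₂⟩ := SemiGraph.exists_abuts_of_isConnected h𝒢.isConnected w e₂
  obtain ⟨v₁, hb₁⟩ := Option.isSome_iff_exists.mp hs₁
  obtain ⟨v₂, hb₂⟩ := Option.isSome_iff_exists.mp hs₂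
  subst hbe₁ hbe₂
  have hb₁₂ : b₁ ≠ b₂ := fun h => hne (by rw [h])
  obtain ⟨g₁, hL₁eq⟩ := edgeLike_eq_map_branchSubgroup c hb₁ hL₁ (Φ v₁) (hΦ v₁)
  obtain ⟨g₂, hL₂eq⟩ := edgeLike_eq_map_branchSubgroup c hb₂ hL₂ (Φ v₂) (hΦ v₂)
  -- the hosts
  set H₁ := (Φ v₁).toMonoidHom.range.map (MulAut.conj g₁).toMonoidHom with hH₁def
  set H₂ := (Φ v₂).toMonoidHom.range.map (MulAut.conj g₂).toMonoidHom with hH₂def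
  have hH₁ : H₁ ∈ verticialSubgroups c v₁ :=
    conj_mem_verticialSubgroups c (range_mem_verticialSubgroups c (Φ v₁) (hΦ v₁)) g₁
  have hH₂ : H₂ ∈ verticialSubgroups c v₂ :=
    conj_mem_verticialSubgroups c (range_mem_verticialSubgroups c (Φ v₂) (hΦ v₂)) g₂
  have hL₁H₁ : L₁ ≤ H₁ := by rw [hL₁eq]; exact Subgroup.map_mono (Subgroup.map_le_range _ _)
  have hL₂H₂ : L₂ ≤ H₂ := by rw [hL₂eq]; exact Subgroup.map_mono (Subgroup.map_le_range _ _)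
  by_contra hK
  -- Case I: equal hosts
  by_cases hH12 : H₁ = H₂
  · exact hb₁₂ (branch_eq_of_hosts_eq hVD hVI h𝒢 c Φ hΦ hK hb₁ hb₂ g₁ g₂
      (by rw [← hL₁eq]; exact inf_le_left) (by rw [← hL₂eq]; exact inf_le_right) hH12)
  -- Case II: distinct hosts; `K = L₁ ⊓ L₂` is compact and nontrivial
  have hKc : IsCompact ((L₁ ⊓ L₂ : Subgroup c.G) : Set c.G) := by
    rw [Subgroup.coe_inf]
    exact (isCompact_of_mem_edgeLikeSubgroups c hL₁).inter_right
      (isCompact_of_mem_edgeLikeSubgroups c hL₂).isClosed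
  -- the second conjunct of Thm 3.7 (iii), UNCONDITIONAL at locally finite `𝔾` (abc-iut-w6-d062)
  obtain ⟨honly, e, L, he, hL, hKL⟩ := 𝒢.compactInTwoVerticial_of_isLocallyFinite h𝒢 hlf c (L₁ ⊓ L₂) hKc
    hK hH₁ hH₂ hH12 (inf_le_left.trans hL₁H₁) (inf_le_right.trans hL₂H₂)
  obtain ⟨b, b', u, u', hbb', hbe, hb'e, hb, hb'⟩ := SemiGraph.exists_branches_of_isClosedEdge he
  subst hbe
  obtain ⟨g, hLeq⟩ := edgeLike_eq_map_branchSubgroup c hb hL (Φ u) (hΦ u)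
  have hL' : L ∈ edgeLikeSubgroups c (𝒢.graph.edgeOf b') := by rw [hb'e]; exact hL
  obtain ⟨g', hLeq'⟩ := edgeLike_eq_map_branchSubgroup c hb' hL' (Φ u') (hΦ u')
  set H := (Φ u).toMonoidHom.range.map (MulAut.conj g).toMonoidHom with hHdef
  set H' := (Φ u').toMonoidHom.range.map (MulAut.conj g').toMonoidHom with hH'def
  have hHm : H ∈ verticialSubgroups c u :=
    conj_mem_verticialSubgroups c (range_mem_verticialSubgroups c (Φ u) (hΦ u)) g
  have hH'm : H' ∈ verticialSubgroups c u' :=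
    conj_mem_verticialSubgroups c (range_mem_verticialSubgroups c (Φ u') (hΦ u')) g'
  have hKH : L₁ ⊓ L₂ ≤ H := hKL.trans (by rw [hLeq]; exact Subgroup.map_mono (Subgroup.map_le_range _ _))
  have hKH' : L₁ ⊓ L₂ ≤ H' :=
    hKL.trans (by rw [hLeq']; exact Subgroup.map_mono (Subgroup.map_le_range _ _))
  -- membership data for `branch_eq_of_hosts_eq`
  have hKLb : L₁ ⊓ L₂ ≤ ((𝒢.branchSubgroup b u hb).map (Φ u).toMonoidHom).map (MulAut.conj g).toMonoidHom := by
    rw [← hLeq]; exact hKL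
  have hKLb' : L₁ ⊓ L₂ ≤
      ((𝒢.branchSubgroup b' u' hb').map (Φ u').toMonoidHom).map (MulAut.conj g').toMonoidHom := by
    rw [← hLeq']; exact hKL
  have hKL₁ : L₁ ⊓ L₂ ≤
      ((𝒢.branchSubgroup b₁ v₁ hb₁).map (Φ v₁).toMonoidHom).map (MulAut.conj g₁).toMonoidHom := by
    rw [← hL₁eq]; exact inf_le_left
  have hKL₂ : L₁ ⊓ L₂ ≤
      ((𝒢.branchSubgroup b₂ v₂ hb₂).map (Φ v₂).toMonoidHom).map (MulAut.conj g₂).toMonoidHom := by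
    rw [← hL₂eq]; exact inf_le_right
  -- the two hosts of `L` are among `H₁`, `H₂`
  rcases honly u H hHm hKH with hH1 | hH2 <;> rcases honly u' H' hH'm hKH' with hH'1 | hH'2
  · -- H = H₁ = H' : the two branches of `e` inside one host
    exact hbb' (branch_eq_of_hosts_eq hVD hVI h𝒢 c Φ hΦ hK hb hb' g g' hKLb hKLb' (hH1.trans hH'1.symm))
  · -- H = H₁, H' = H₂ : `b = b₁`, `b' = b₂`, so `e₁ = e = e₂`
    have h1 := branch_eq_of_hosts_eq hVD hVI h𝒢 c Φ hΦ hK hb hb₁ g g₁ hKLb hKL₁ hH1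
    have h2 := branch_eq_of_hosts_eq hVD hVI h𝒢 c Φ hΦ hK hb' hb₂ g' g₂ hKLb' hKL₂ hH'2
    subst h1 h2
    exact hne hb'e.symm
  · -- H = H₂, H' = H₁
    have h1 := branch_eq_of_hosts_eq hVD hVI h𝒢 c Φ hΦ hK hb hb₂ g g₂ hKLb hKL₂ hH2
    have h2 := branch_eq_of_hosts_eq hVD hVI h𝒢 c Φ hΦ hK hb' hb₁ g' g₁ hKLb' hKL₁ hH'1
    subst h1 h2
    exact hne hb'e
  · -- H = H₂ = H'
    exact hbb' (branch_eq_of_hosts_eq hVD hVI h𝒢 c Φ hΦ hK hb hb' g g' hKLb hKLb' (hH2.trans hH'2.symm))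

/-- **`EdgeLikeDistinct`, unfolded, at every locally finite Thm-3.7 graph**: for distinct edges `e₁ ≠ e₂` and
edge-like `L₁`, `L₂`, `[L₁ : L₁ ∩ L₂] = ∞`, i.e. `L₂.relIndex L₁ = 0` (trivial intersection, `L₁` infinite by
abc-iut-w4-d075's `infinite_of_mem_edgeLikeSubgroups`). [cite: MochizukiSemiAnbd2006, Thm 3.7(iv) p.41] -/
theorem relIndex_edgeLike_eq_zero_of_isLocallyFinite (h𝒢 : 𝒢.Thm37Hypotheses) (hlf : 𝒢.graph.IsLocallyFinite)
    (c : TemperedPiChart 𝒢) {e₁ e₂ : 𝒢.graph.Edge} (hne : e₁ ≠ e₂) {L₁ L₂ : Subgroup c.G}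
    (hL₁ : L₁ ∈ edgeLikeSubgroups c e₁) (hL₂ : L₂ ∈ edgeLikeSubgroups c e₂) : L₂.relIndex L₁ = 0 := by
  haveI := infinite_of_mem_edgeLikeSubgroups verticialInjective_holds h𝒢 c hL₁
  have hbot : L₂ ⊓ L₁ = ⊥ := by
    rw [inf_comm]; exact edgeLike_inf_edgeLike_eq_bot_of_isLocallyFinite h𝒢 hlf c hne hL₁ hL₂
  rw [← Subgroup.inf_relIndex_right, hbot, Subgroup.relIndex_bot_left]
  exact Nat.card_eq_zero_of_infinite

/-- **F-1699 `EdgeLikeDistinct`, instance form, UNCONDITIONALLY at every locally finite countable graph of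
anabelioids** (the hypotheses of Thm 3.7 are part of the statement `EdgeLikeDistinctAt 𝒢`): edge-like subgroups
of distinct edges have infinite mutual index, for every chart.  Covers every finite `𝔾` (the IUT carriers) and
the countable locally finite ones such as `𝒢_θ`. [cite: MochizukiSemiAnbd2006, Thm 3.7(iv) p.41] -/
theorem edgeLikeDistinctAt_of_isLocallyFinite (hlf : 𝒢.graph.IsLocallyFinite) : EdgeLikeDistinctAt 𝒢 :=
  fun h𝒢 c _ _ _ _ hL₁ hL₂ hne => relIndex_edgeLike_eq_zero_of_isLocallyFinite h𝒢 hlf c hne hL₁ hL₂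

/-! ### Instances at the countermodel `𝒢_θ` of the Thm 3.7 (iii) refutation -/

section ThetaRay

variable {G E : Type} [Group G] [TopologicalSpace G] [IsTopologicalGroup G] [CompactSpace G]
  [TotallyDisconnectedSpace G] [Group E] [TopologicalSpace E] [IsTopologicalGroup E] [CompactSpace E]
  [TotallyDisconnectedSpace E] {up : E →ₜ* G} {low : ℕ → (E →ₜ* G)}

/-- **`EdgeLikeDistinctAt` HOLDS at every theta ray of groups** (the underlying semi-graph is the locally finite
ray), in particular at the countermodel `𝒢_θ` where the ∀-countable (iii) fails. [cite: MochizukiSemiAnbd2006, Thm 3.7(iv) p.41] -/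
theorem thetaRay_edgeLikeDistinctAt : EdgeLikeDistinctAt (thetaRay G E up low) :=
  edgeLikeDistinctAt_of_isLocallyFinite SemiGraph.ray_isLocallyFinite

end ThetaRay

/-- **`EdgeLikeDistinctAt (thetaRayFreeProP p n)`** — F-1699 HOLDS at abc-iut-L3-d1's countermodel
`𝒢_θ(p, n)` (any schedule `n`), where `CompactInVerticialAt` (F-1732) and `MaximalCompactIffVerticialAt`
(F-1750) fail (p442260, p443103): typed-form sweep row B3. [cite: MochizukiSemiAnbd2006, Thm 3.7(iv) p.41] -/
theorem thetaRayFreeProP_edgeLikeDistinctAt (p : ℕ) [Fact p.Prime] (n : ℕ → ℕ) :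
    EdgeLikeDistinctAt (thetaRayFreeProP p n) :=
  edgeLikeDistinctAt_of_isLocallyFinite SemiGraph.ray_isLocallyFinite

end ProfiniteSemiGraph

end Literature.AnabelianGeometry.SemiGraphs
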